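import Summits.Langlands.Statement
import Literature.NumberTheory.Automorphic.TunnellOctahedralGlobal
import Literature.NumberTheory.Automorphic.ReciprocityGLnPatchingAssembly
import Literature.NumberTheory.Automorphic.ReciprocityGLnRestrictionProofs
import Literature.NumberTheory.GaloisRepresentations.RestrictFieldSemisimple
import Literature.NumberTheory.GaloisRepresentations.FramedRepEquivConj
import Summits.Langlands.Langlands.Theorems.BaseFieldAscentReciprocityTRCMStubAutToGalCMtoTR

/-!
# Sorensen family patching of almost-everywhere avatars (support for `RootDecomp1.AvatarDescent`)

Support file for stmt-Langlands-29149 `RootDecomp1.AvatarDescent` (it does NOT close that item): the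
kernel edge §1 of the lens-4 (gen 27) node `SorensenFamilyDescent` of the decomp-langlands cell
(run/shared/lean/pub/decomp-langlands/nodes/lens-4-g27-SorensenFamilyDescent.lean, critic row 350,
CLEARED), extracted verbatim.  THE FAMILY TRANSPORT, PROVED: if `π` is an automorphic representation of
`GL_n(𝔸_K)` and every member `P_D` (`D ∈ GoodPrime K m B`, the tree's `∅`-general quadratic family
`K(√-D)`) of a family of a.e. weak base changes of `π` has a semisimple `ℓ`-adic a.e. Satake–Frobenius
avatar `r_D`, then ONE semisimple `ρ : Γ_K → GL_n(ℚ̄_ℓ)` restricts to an a.e. avatar of every `P_D`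
(`familyPatchedAvatar`).  Inputs, all tree theorems: the L-normalised Frobenius datum of `π`
(the landed `ReciprocityTRCM.exists_frobDatum_one`), `CompatibleAE` of members' avatars with it
(`compatibleAE_of_satakeFrobCompatibleAt`), and the tree's Sorensen patching over the `∅`-general family
`Literature.NumberTheory.GaloisRepresentations.QuadraticFamily.GoodPrime.exists_framedGaloisRep_of_compatibleAE`
(hypotheses (a) `ρ_D^τ ≅ ρ_D`, (b) `ρ_D ≅ ρ_{D'}` on the compositum by Chebotarev–Brauer–Nesbitt).
This makes `AvatarDescent ⇐ LayerwiseAvatarDescent` (the node's LAD) available to RootDecomp1 provers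
independently of any route birth.

References: C. M. Sorensen, *A patching lemma*, §1 Lemma 2 and Example [cite: Sorensen2020];
M. Harris, R. Taylor, *The geometry and cohomology of some simple Shimura varieties*, Ann. of Math.
Stud. 151 (2001), proof of Thm. VII.1.9 [cite: HarrisTaylorAMS2001]; S. Patrikis, R. Taylor,
*Automorphy and irreducibility of some l-adic representations*, Compos. Math. 151 (2015) §1
(«strongly ∅-general» families).
-/

set_option linter.dupNamespace false

open scoped NumberField Classical MatrixGroups Polynomial
open NumberField IsDedekindDomain Filter Polynomial
open Literature.NumberTheory.Automorphic Literature.NumberTheory.GaloisRepresentations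
open Literature.NumberTheory.GaloisRepresentations.QuadraticFamily
open Literature.NumberTheory.Automorphic.PatchingFamily

namespace Summit.Langlands.Langlands.Theorems.SorensenFamilyPatching

variable {K : Type} [Field K] [NumberField K] {n : ℕ} {hcpt : isCompact_glFiniteIntegralLevel n K}
  {ℓ : ℕ} [Fact ℓ.Prime]

/-- **Members' a.e.-avatars are `CompatibleAE` with the datum of `π`.**  If `P` on `GL_n/K(√-D)` is an
a.e. weak base change of `π` (`IsWeakBaseChangeLiftAE`: `t_{P,w} = t_{π,v}^{f(w|v)}` a.e.) and `r` over
`K(√-D)` is Satake–Frobenius compatible with `P` almost everywhere, then `r` is compatible almost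
everywhere with the L-normalised Frobenius datum `E` of `π` (`frobPoly E v f = ∏ (X - a^f)`):
uniqueness of Satake parameters, `q_w = q_v^f`, `arithFrobPolyOfSatake_pow`. [folklore] -/
theorem compatibleAE_of_satakeFrobCompatibleAt (π : AutomorphicRepData (AutomorphyDatum.gl n K hcpt))
    (ι : PadicAlgCl ℓ ≃+* ℂ) {E : HeightOneSpectrum (𝓞 K) → Multiset (PadicAlgCl ℓ)}
    (hE : ∀ (v : HeightOneSpectrum (𝓞 K)) (α : Multiset ℂ), π.HasSatakeParamAt v α →
      ((E v).map fun a ↦ X - C a).prod = arithFrobPolyOfSatake ι v.residueCard 1 α)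
    {M : Type} [Field M] [NumberField M] [Algebra K M] {hM : isCompact_glFiniteIntegralLevel n M}
    (P : AutomorphicRepData (AutomorphyDatum.gl n M hM)) (hBC : IsWeakBaseChangeLiftAE π P)
    (r : FramedGaloisRep M (PadicAlgCl ℓ) n)
    (hr : ∀ᶠ w : HeightOneSpectrum (𝓞 M) in cofinite, SatakeFrobCompatibleAt ι P r w) :
    CompatibleAE E r := by
  have hπunr : ∀ᶠ v : HeightOneSpectrum (𝓞 K) in cofinite, π.IsUnramifiedAt v :=
    π.hasSatakeParamAt_cofinite_holds
  have hbc : ∀ᶠ w : HeightOneSpectrum (𝓞 M) in cofinite, ∀ (v : HeightOneSpectrum (𝓞 K)) (α : Multiset ℂ),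
      w.asIdeal.under (𝓞 K) = v.asIdeal → π.HasSatakeParamAt v α →
        P.HasSatakeParamAt w (α.map (· ^ w.asIdeal.inertiaDeg (𝓞 K))) := hBC
  show ∀ᶠ w : HeightOneSpectrum (𝓞 M) in cofinite, _
  filter_upwards [hr, hbc, Literature.NumberTheory.Automorphic.eventually_under (E := M) hπunr]
    with w hw hwbc hwπ
  obtain ⟨α, hα⟩ := hwπ (w.under (𝓞 K)) rfl
  obtain ⟨β, hβ, hunr, hch⟩ := hw
  have hβ' : P.HasSatakeParamAt w (α.map (· ^ w.asIdeal.inertiaDeg (𝓞 K))) :=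
    hwbc (w.under (𝓞 K)) α rfl hα
  obtain rfl : β = α.map (· ^ w.asIdeal.inertiaDeg (𝓞 K)) := P.hasSatakeParamAt_unique_holds hβ hβ'
  refine ⟨hunr, ?_⟩
  rw [residueCard_eq_residueCard_pow_inertiaDeg (v := w.under (𝓞 K)) (w := w) rfl,
    arithFrobPolyOfSatake_pow] at hch
  have hroots : E (w.under (𝓞 K)) =
      (arithFrobPolyOfSatake ι (w.under (𝓞 K)).residueCard 1 α).roots := by
    rw [← hE _ α hα, Polynomial.roots_multiset_prod_X_sub_C]
  rw [frobPoly_eq_prod_map_pow, hroots]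
  exact hch

/-- **THE FAMILY TRANSPORT, PROVED (Sorensen patching of a.e.-avatars).**  Let `π` be an automorphic
representation of `GL_n(𝔸_K)`, `(K(√-D))_{D ∈ GoodPrime K m B}` the tree's `∅`-general quadratic family
(`m ≠ 0`, `B` finite), `P_D` on `GL_n/K(√-D)` a.e. weak base changes of `π`, and suppose every `P_D` has
a SEMISIMPLE `ℓ`-adic `r_D` Satake–Frobenius compatible with it almost everywhere.  Then there is ONE
semisimple `ρ : Γ_K → GL_n(ℚ̄_ℓ)` whose restriction to every `Γ_{K(√-D)}` is Satake–Frobenius compatible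
with `P_D` almost everywhere.  Proof: each `r_D` is `CompatibleAE` with the L-normalised datum of `π`
(`compatibleAE_of_satakeFrobCompatibleAt`), so the tree's
`GoodPrime.exists_framedGaloisRep_of_compatibleAE` (Sorensen's (a), (b) by Chebotarev–Brauer–Nesbitt,
patching over the `∅`-general family) yields `ρ` with `ρ|_{Γ_{K(√-D)}} ≅ r_D`, and Satake–Frobenius
compatibility is an isomorphism invariant (`isUnramifiedAt_of_equiv`, `hasFrobCharpolyAt_of_equiv`).
[cite: Sorensen2020, §1 Lemma 2 and Example] [cite: HarrisTaylorAMS2001, proof of Thm. VII.1.9] -/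
theorem familyPatchedAvatar (π : AutomorphicRepData (AutomorphyDatum.gl n K hcpt)) {m : ℕ} {B : Set ℕ}
    (hm : m ≠ 0) (hB : B.Finite)
    (hM : ∀ D : GoodPrime K m B, isCompact_glFiniteIntegralLevel n (sqrtNegField K D.1))
    (P : ∀ D : GoodPrime K m B, AutomorphicRepData (AutomorphyDatum.gl n (sqrtNegField K D.1) (hM D)))
    (hBC : ∀ D, IsWeakBaseChangeLiftAE π (P D)) (ι : PadicAlgCl ℓ ≃+* ℂ)
    (hfam : ∀ D, ∃ r : FramedGaloisRep (sqrtNegField K D.1) (PadicAlgCl ℓ) n,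
      r.toGaloisRep.IsSemisimple ∧
        ∀ᶠ w : HeightOneSpectrum (𝓞 (sqrtNegField K D.1)) in cofinite, SatakeFrobCompatibleAt ι (P D) r w) :
    ∃ ρ : FramedGaloisRep K (PadicAlgCl ℓ) n, ρ.toGaloisRep.IsSemisimple ∧
      ∀ D, ∀ᶠ w : HeightOneSpectrum (𝓞 (sqrtNegField K D.1)) in cofinite,
        SatakeFrobCompatibleAt ι (P D) (ρ.restrictField (sqrtNegField K D.1)) w := by
  classical
  choose r hrss hr using hfam
  obtain ⟨E, hE⟩ := ReciprocityTRCM.exists_frobDatum_one π ι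
  have hcomp : ∀ D, CompatibleAE E (r D) := fun D ↦
    compatibleAE_of_satakeFrobCompatibleAt π ι hE (P D) (hBC D) (r D) (hr D)
  obtain ⟨ρ, hρss, hρ, -⟩ :=
    GoodPrime.exists_framedGaloisRep_of_compatibleAE hm hB E r hrss hcomp ∅ (fun v hv ↦ hv.elim)
  refine ⟨ρ, hρss, fun D ↦ ?_⟩
  set e := Classical.choice (hρ D)
  filter_upwards [hr D] with w hw
  obtain ⟨β, hβ, hunr, hch⟩ := hw
  exact ⟨β, hβ, FramedGaloisRep.isUnramifiedAt_of_equiv e.symm hunr,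
    FramedGaloisRep.hasFrobCharpolyAt_of_equiv e.symm hch⟩

end Summit.Langlands.Langlands.Theorems.SorensenFamilyPatching
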